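import Literature.IUT.HodgeTheaters.PMBaseIsoTorsorExactSideCondition
import Literature.IUT.HodgeTheaters.PMBaseIsoTorsorTwistedHT

/-!
# [IUTchI] Prop 6.6 (iii) and Prop 6.8 (i) over a kit: the EXACT side condition (FACT-LIST F-2018, sequel)

S. Mochizuki, *Inter-universal Teichmüller theory I: construction of Hodge theaters*, §6, Example 6.3 (i),
(ii) pp. 160–161, Proposition 6.6 (ii), (iii) p. 165, Proposition 6.8 (i) pp. 167–168 of the kurims manuscript
(May 2020) [claim: Mochizuki2012, status: disputed].  PROOF-ONLY companion (theorems, no definitions) of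
abc-iut-L5-t4's `PMBaseBridgeProps.lean` / `PMBaseProcessions.lean` (abc-iut cell, block F fact-proving wave,
seat abc-iut-f-071 gen 4; FACT-LIST row F-2018 `IsoTorsor`).

`PMBaseIsoTorsorExactSideCondition.lean` settled the exact side condition of Prop 6.6 (ii) over a kit: the
TWISTED `[−1]`-compatibility (ONE `d ∈ 𝔽_l`; at every `v` a negative automorphism `a_v` of `𝒟_v` and a lift
`b ∈ Aut_±(𝒟^{⊚±})` of `(d, −1)` with `a_v ≫ φ^{Θell}_{•,v} = φ^{Θell}_{•,v} ≫ b`).  This file shows that the SAME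
condition is the exact side condition of Prop 6.6 (iii) (`DThetaPMEllHT.IsoTorsor`, all pairs) and of Prop 6.8 (i)
(`DThetaPMEllHT.EllBridgeSymmetry`, all theaters):

* `DThetaEllBridge.twistedNegCompat_of_negAut` — the core extraction: ONE automorphism of the model
  `𝒟-Θ^{ell}`-bridge of Example 6.3 (i) with index bijection `t ↦ −t` already yields the twisted form (the proof
  of `twistedNegCompat_of_isoTorsor_model`, which only used such an automorphism);
* `DThetaEllBridge.exists_negAut_model_of_negAut_modelTheater` — transfers such an automorphism of the underlying
  `𝒟-Θ^{ell}`-bridge of the MODEL `𝒟-Θ^{±ell}`-Hodge theater `Ex62.ht K` (same capsule, global object, poly-morphisms;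
  torsor structure on `T = 𝔽_l` induced by the tautological group structure, same charts) to `Ex63.bridge K`;
* `DThetaPMEllHT.forall_isoTorsor_iff_twistedNegCompat` — **Prop 6.6 (iii): exact side condition**;
  `DThetaPMEllHT.forall_ellBridgeSymmetry_iff_twistedNegCompat` — **Prop 6.8 (i): exact side condition** (the
  count `2·|T|` of automorphisms of the underlying `𝒟-Θ^{ell}`-bridge of the model theater forces, by rigidity,
  an automorphism with index bijection `t ↦ −t`);
* `exists_kit_forall_isoTorsorHT_not_negCompatModel` — at the separating kit of
  `exists_kit_forall_isoTorsor_not_negCompatModel` Prop 6.6 (iii) holds for ALL pairs of theaters while (β) fails.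

So for each of the three (β)-conditional rows Prop 6.6 (ii), 6.6 (iii), 6.8 (i) the necessary-and-sufficient
kit-level input is the twisted form, strictly weaker than (β) = `Ex63.NegCompatModel` (= twisted form ∧ (α)).
No side taken on [IUTchIII] Cor. 3.12; nothing asserted about the genuine objects of [IUTchI]; typed ≠ proved;
a FACT-LIST row is an assumption label, proved/refuted = OUR kernel check only. -/

namespace Literature.IUT.HodgeTheaters

open CategoryTheory

universe u

namespace PMBaseKit

variable {l : ℕ} {K : PMBaseKit.{u} l}

namespace DThetaEllBridge

/-- **Core extraction** ([IUTchI] Ex 6.3 (i) p. 161, Def 6.4 (ii) p. 163): an automorphism `g` of the model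
`𝒟-Θ^{ell}`-bridge of Example 6.3 (i) whose index bijection is `t ↦ −t` yields the twisted `[−1]`-compatibility —
`d` is the fixed-chart value of `LabCusp^±(ψ)` at the class of chart-value `0`, `ψ` the global constituent of `g`;
at each `v` the negative automorphism of `𝒟_v` and the lift `ψ ≫ (csp)⁻¹` are read off the compatibility square at
the label `0`, the positive alternative being excluded by the square at the label `1` (`1 = −1` in `𝔽_l`).
[claim: Mochizuki2012, status: disputed] -/
theorem twistedNegCompat_of_negAut [NeZero l] (g : Iso (Ex63.bridge K) (Ex63.bridge K))
    (hκ : g.indexEquiv = Equiv.neg (ZMod l)) :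
    ∃ d : ZMod l, ∀ v, ∃ a : K.model v ≅ K.model v, K.labMap v a = labNeg (K.isLocal_model v) ∧
      ∃ b ∈ Ex63.lifts K (FlPM.mk d (-1)), a.hom ≫ K.phiEll v = K.phiEll v ≫ (K.atV v).map b.hom := by
  classical
  obtain ⟨ψ, hψ⟩ := g.globPoly_orbit
  obtain ⟨ψ, rfl⟩ : ∃ ψ' : Aut K.gModel, ψ' = ψ := ⟨ψ, rfl⟩
  have hψmem : ψ ∈ g.globPoly := by
    rw [hψ]
    exact ⟨1, one_mem _, (Iso.trans_refl _).symm⟩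
  refine ⟨K.gChart₀ (K.gLabMap ψ (K.gChart₀.symm 0)), fun v => ?_⟩
  -- `φ_v` itself is a member of `φ^{Θell}_{v_0}`
  have h1 : (1 : Aut K.gModel) ∈ Ex63.lifts K (FlPM.transl 0) := by
    rw [Ex63.lifts_transl_zero]; exact one_mem _
  have hf : K.phiEll v ∈ Ex63.poly K 0 v :=
    ⟨1, one_mem _, 1, h1, by change K.phiEll v = 𝟙 _ ≫ K.phiEll v ≫ (K.atV v).map (𝟙 _); simp⟩
  -- the bijection induced by `φ^{Θell}_{v_s}` is `LabCusp^±(b_s) ∘ (that of φ_v)`, `b_s` any lift of `s`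
  have hζval : ∀ (s : ZMod l) (ζ : K.LabCuspPM v (K.model v) ≃ K.GLab K.gModel),
      (Ex63.bridge K).ZetaSpec s v ζ → ∀ {bs : Aut K.gModel}, bs ∈ Ex63.lifts K (FlPM.transl s) →
        ∀ x, ζ x = K.gLabMap bs (K.labOfHom v (K.phiEll v) x) := by
    intro s ζ hζ bs hbs x
    have hfs : K.phiEll v ≫ (K.atV v).map bs.hom ∈ (Ex63.bridge K).poly s v :=
      ⟨1, one_mem _, bs, hbs, by change _ = 𝟙 _ ≫ _; exact (Category.id_comp _).symm⟩
    have this : K.labOfHom v (K.phiEll v ≫ (K.atV v).map bs.hom) x = ζ x := congrFun (hζ.1 _ hfs) x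
    rw [K.labOfHom_post] at this
    exact this.symm
  -- read the compatibility square of `g` at `(0, v)` on the member `φ_v ≫ ψ`
  have hmem : K.phiEll v ≫ (K.atV v).map ψ.hom ∈
      {h | ∃ p ∈ g.capsPoly (0 : ZMod l), ∃ g₂ ∈ (Ex63.bridge K).poly (g.indexEquiv (0 : ZMod l)) v,
        h = (p v).hom ≫ g₂} := by
    rw [g.compat (0 : ZMod l) v]
    exact ⟨K.phiEll v, hf, ψ, hψmem, rfl⟩
  obtain ⟨p, -, g₂, hg₂, heq⟩ := hmem
  -- normalise the types of the constituents (the capsule members of the model bridge ARE the `𝒟_v`)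
  obtain ⟨pv, g₂, hg₂, heq⟩ : ∃ (pv : K.model v ≅ K.model v) (f : K.model v ⟶ (K.atV v).obj K.gModel),
      f ∈ Ex63.poly K (g.indexEquiv (0 : ZMod l)) v ∧ K.phiEll v ≫ (K.atV v).map ψ.hom = pv.hom ≫ f :=
    ⟨p v, g₂, hg₂, heq⟩
  have hidx0 : g.indexEquiv (0 : ZMod l) = (0 : ZMod l) := by
    rw [hκ]; exact (congrFun (Equiv.neg_apply (ZMod l)) 0).trans neg_zero
  have hκ1 : g.indexEquiv (1 : ZMod l) = (-1 : ZMod l) := by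
    rw [hκ]; exact congrFun (Equiv.neg_apply (ZMod l)) 1
  rw [hidx0] at hg₂
  obtain ⟨a', -, b', hb', rfl⟩ := hg₂
  rw [Ex63.lifts_transl_zero] at hb'
  -- the automorphism `n := p_v ≫ a'` of `𝒟_v` and the global `ψ ≫ b'⁻¹`
  let n : K.model v ≅ K.model v := pv ≪≫ a'
  have hn : n.hom ≫ K.phiEll v = K.phiEll v ≫ (K.atV v).map (ψ ≪≫ b'.symm).hom := by
    have h2 := heq =≫ (K.atV v).map b'.inv
    simp only [Category.assoc, Iso.map_hom_inv_id, Category.comp_id] at h2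
    show (pv ≪≫ a').hom ≫ K.phiEll v = K.phiEll v ≫ (K.atV v).map (ψ ≪≫ b'.symm).hom
    rw [Iso.trans_hom, Iso.trans_hom, Iso.symm_hom, Functor.map_comp, Category.assoc]
    exact h2.symm
  -- the square on `±`-label classes of cusps
  have hsq := Ex63.labOfHom_phiEll_comp_labMap hn
  have hb'1 : K.gLabMap b' = Equiv.refl _ := MonoidHom.mem_ker.mp hb'
  have hgl : K.gLabMap (ψ ≪≫ b'.symm) = K.gLabMap ψ := by
    rw [K.gLabMap_trans, gLabMap_symm, hb'1]
    ext y
    rfl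
  rw [hgl] at hsq
  set S := K.labPM v (K.model v) (K.isLocal_model v) with hS
  rcases labMap_eq_refl_or_labNeg (K.isLocal_model v) n with hn0 | hn0
  · -- `n` positive: then `LabCusp^±(ψ)` is trivial, and the square of `g` at `t = 1` reads `1 = −1`
    exfalso
    have hψid : ∀ y, K.gLabMap ψ y = y := fun y => by
      obtain ⟨x, rfl⟩ := (K.labOfHom_phiEll_bijective v).2 y
      have := congrFun hsq x
      simp only [Function.comp_apply, hn0, Equiv.refl_apply] at this
      exact this.symm
    obtain ⟨φ1, hφ1⟩ := g.capsPoly_plusFull (1 : ZMod l)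
    obtain ⟨ζ₁, hζ₁⟩ : ∃ ζ : K.LabCuspPM v (K.model v) ≃ K.GLab K.gModel,
        (Ex63.bridge K).ZetaSpec (1 : ZMod l) v ζ := (Ex63.bridge K).inducesZeta (1 : ZMod l) v
    obtain ⟨ζ₂, hζ₂⟩ : ∃ ζ : K.LabCuspPM v (K.model v) ≃ K.GLab K.gModel,
        (Ex63.bridge K).ZetaSpec (g.indexEquiv (1 : ZMod l)) v ζ :=
      (Ex63.bridge K).inducesZeta (g.indexEquiv (1 : ZMod l)) v
    obtain ⟨b₁, hb₁⟩ := Ex63.lifts_nonempty (K := K) (FlPM.transl 1)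
    obtain ⟨b₂, hb₂⟩ := Ex63.lifts_nonempty (K := K) (FlPM.transl (g.indexEquiv (1 : ZMod l)))
    let φv : K.model v ≅ K.model v := φ1 v
    have hz : ∀ x : K.LabCuspPM v (K.model v), K.gLabMap ψ (ζ₁ x) = ζ₂ (K.labMap v φv x) :=
      fun x => DFunLike.congr_fun (g.zeta_trans_gLabMap (1 : ZMod l) v hφ1 hψmem hζ₁ hζ₂) x
    -- a label class fixed by `LabCusp^±(φ_v)`: the class of chart-value `0`
    have hxfix : K.labMap v φv (S.chart₀.symm 0) = S.chart₀.symm 0 := by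
      rcases labMap_eq_refl_or_labNeg (K.isLocal_model v) φv with h0 | h0
      · rw [h0]; rfl
      · rw [h0]; simp [labNeg, hS]
    have hzx : ζ₁ (S.chart₀.symm 0) = ζ₂ (S.chart₀.symm 0) := by
      have := hz (S.chart₀.symm 0)
      rwa [hψid, hxfix] at this
    -- in the fixed chart: `G + 1 = G + (−1)`
    have key := congrArg K.gChart₀ hzx
    rw [hζval 1 ζ₁ hζ₁ hb₁, hζval (g.indexEquiv (1 : ZMod l)) ζ₂ hζ₂ hb₂,
      ((Ex63.mem_lifts_iff_gChart₀ _ _).mp hb₁).2, ((Ex63.mem_lifts_iff_gChart₀ _ _).mp hb₂).2,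
      FlPM.transl_smul, FlPM.transl_smul, hκ1, add_right_inj] at key
    exact two_ne_zero_of_isLocal (K.isLocal_model v) (by linear_combination key)
  · -- `n` negative: `ψ ≫ b'⁻¹` is a lift of `(d, −1)`, `d` read off `LabCusp^±(ψ)` in the fixed chart
    have hψlam : ∀ x, K.gLabMap ψ (K.labOfHom v (K.phiEll v) x) =
        K.labOfHom v (K.phiEll v) (labNeg (K.isLocal_model v) x) := fun x => by
      have := congrFun hsq x
      simp only [Function.comp_apply, hn0] at this
      exact this.symm
    -- the chart `S.chart₀` pulled back along `φ_v` is `γ₀`-affine relative to the fixed chart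
    obtain ⟨γ₀, hγ₀⟩ := K.gLabT.exists_of_mem K.gChart₀_mem
      (K.labOfHom_phiEll_charts v S.chart₀ S.chart₀_mem)
    have hE : ∀ x, S.chart₀ x = γ₀ • K.gChart₀ (K.labOfHom v (K.phiEll v) x) := fun x => by
      have := congrArg (fun f => f (Equiv.ofBijective _ (K.labOfHom_phiEll_bijective v) x)) hγ₀
      simpa using this
    have hN : ∀ x, S.chart₀ (labNeg (K.isLocal_model v) x) = -S.chart₀ x := fun x => by
      simp [labNeg, hS]
    -- `LabCusp^±(ψ)` in the fixed chart: `G ↦ −G + dv`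
    set dv : ZMod l := -(γ₀.right • (γ₀.left.toAdd + γ₀.left.toAdd)) with hdv
    have hform : ∀ x, K.gChart₀ (K.labOfHom v (K.phiEll v) (labNeg (K.isLocal_model v) x)) +
        K.gChart₀ (K.labOfHom v (K.phiEll v) x) = dv := fun x => by
      have h := hN x
      rw [hE, hE, FlPM.smul_def, FlPM.smul_def] at h
      rw [hdv]
      rcases Int.units_eq_one_or γ₀.right with h1 | h1 <;> rw [h1] at h ⊢
      · simp only [one_smul] at h ⊢
        linear_combination h
      · simp only [Units.neg_smul, one_smul] at h ⊢
        linear_combination -h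
    have hψG : ∀ y, K.gChart₀ (K.gLabMap ψ y) = -K.gChart₀ y + dv := fun y => by
      obtain ⟨x, rfl⟩ := (K.labOfHom_phiEll_bijective v).2 y
      rw [hψlam]
      linear_combination hform x
    have hd : K.gChart₀ (K.gLabMap ψ (K.gChart₀.symm 0)) = dv := by
      rw [hψG, Equiv.apply_symm_apply, neg_zero, zero_add]
    -- `ψ ∈ Aut_±(𝒟^{⊚±})`: its action on `±`-label classes is in `Aut_±` of the torsor (clause `gLab_range`)
    have hψPM' : (K.gLabMap ψ : Equiv.Perm (K.GLab K.gModel)) ∈ K.gLabT.autPM := by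
      rw [FlPMTorsor.mem_autPM_iff_exists]
      refine ⟨K.gChart₀, K.gChart₀_mem, FlPM.mk dv (-1), fun y => ?_⟩
      rw [hψG, FlPM.mk_smul, Units.neg_smul, one_smul]
    obtain ⟨α, hα1, hα2⟩ := (K.gLab_range _).mp hψPM'
    have hψPM : ψ ∈ K.autPMg K.gModel := by
      have hcsp : (ψ ≪≫ α.symm : Aut K.gModel) ∈ K.autCsp K.gModel := by
        show K.gLabMap (ψ ≪≫ α.symm) = Equiv.refl _
        rw [K.gLabMap_trans, gLabMap_symm, hα2, Equiv.self_trans_symm]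
      have hαPM : α ∈ K.autPMg K.gModel := (K.mem_autPMg_iff α).mpr hα1
      have h3 := (K.autPMg K.gModel).mul_mem hαPM (K.autCsp_le_autPMg _ hcsp)
      have h4 : (ψ ≪≫ α.symm) ≪≫ α = ψ := by
        rw [Iso.trans_assoc, Iso.symm_self_id, Iso.trans_refl]
      rwa [Aut.Aut_mul_def, h4] at h3
    have hψlift : ψ ∈ Ex63.lifts K (FlPM.mk (K.gChart₀ (K.gLabMap ψ (K.gChart₀.symm 0))) (-1)) := by
      refine (Ex63.mem_lifts_iff_gChart₀ _ _).mpr ⟨hψPM, fun y => ?_⟩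
      rw [hd, hψG, FlPM.mk_smul, Units.neg_smul, one_smul]
    have hb'symm : b'.symm ∈ K.autCsp K.gModel := (K.autCsp K.gModel).inv_mem hb'
    exact ⟨n, hn0, ψ ≪≫ b'.symm, Ex63.trans_csp_mem_lifts hψlift hb'symm, hn⟩


end DThetaEllBridge

/-! ### The two `𝔽_l^±`-torsor structures on `T = 𝔽_l`; negation -/

/-- The `𝔽_l^±`-torsor structure on `𝔽_l` induced by the tautological `𝔽_l^±`-GROUP structure (Def 6.4 (iii)
"the `𝔽_l^±`-torsor structure determined by the `𝔽_l^±`-group structure") has the same charts as the tautological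
`𝔽_l^±`-TORSOR structure: all of `𝔽_l^{⋊±}` ([IUTchI] Def 6.1 (i) p. 155). [claim: Mochizuki2012, status: disputed] -/
theorem _root_.Literature.IUT.HodgeTheaters.FlPMGroup.toTorsor_tautological_charts (l : ℕ) :
    (FlPMGroup.tautological l).toTorsor.charts = (FlPMTorsor.tautological l).charts := by
  ext f
  constructor
  · rintro ⟨e, ⟨ε, rfl⟩, g, rfl⟩
    refine ⟨g * FlPM.mk 0 ε, ?_⟩
    ext z
    simp [FlPM.mk_smul]
  · rintro ⟨g, rfl⟩
    refine ⟨signPerm l 1, ⟨1, rfl⟩, g, ?_⟩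
    ext z
    simp

/-- `t ↦ −t` is an automorphism of the tautological `𝔽_l^±`-torsor `𝔽_l` ([IUTchI] Def 6.1 (i) p. 155).
[claim: Mochizuki2012, status: disputed] -/
theorem _root_.Literature.IUT.HodgeTheaters.FlPMTorsor.tautological_compat_neg (l : ℕ) :
    (FlPMTorsor.tautological l).Compat (FlPMTorsor.tautological l) (Equiv.neg (ZMod l)) := by
  rintro e ⟨g, rfl⟩
  refine ⟨g * FlPM.mk 0 (-1), ?_⟩
  ext z
  simp [FlPM.mk_smul, Units.neg_smul]

/-- The negation of the tautological `𝔽_l^±`-group `𝔽_l` is `t ↦ −t` ([IUTchI] Def 6.1 (i) p. 155).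
[claim: Mochizuki2012, status: disputed] -/
theorem _root_.Literature.IUT.HodgeTheaters.FlPMGroup.tautological_neg_apply (l : ℕ) (t : ZMod l) :
    (FlPMGroup.tautological l).neg t = -t := by
  have h := (FlPMGroup.tautological l).chart_neg (e := signPerm l 1) ⟨1, rfl⟩ t
  simpa using h

/-! ### Transfer from the model `𝒟-Θ^{±ell}`-Hodge theater to the model `𝒟-Θ^{ell}`-bridge -/

namespace DThetaEllBridge

/-- An automorphism with index bijection `t ↦ −t` of the underlying `𝒟-Θ^{ell}`-bridge of the MODEL
`𝒟-Θ^{±ell}`-Hodge theater `(𝔇_≻ ⟵ 𝔇_± ⟶ 𝒟^{⊚±})` of Examples 6.2 (i) / 6.3 (i) ([IUTchI] Def 6.4 (iii) p. 163) IS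
such an automorphism of the model `𝒟-Θ^{ell}`-bridge of Example 6.3 (i): same capsule, global object and
poly-morphisms; only the `𝔽_l^±`-torsor structure on `T = 𝔽_l` is presented differently (induced by the tautological
group structure), with the same charts (`FlPMGroup.toTorsor_tautological_charts`).
[claim: Mochizuki2012, status: disputed] -/
theorem exists_negAut_model_of_negAut_modelTheater [NeZero l]
    (g' : Iso (Ex62.ht K).ellBridge (Ex62.ht K).ellBridge) (hκ' : ∀ t : ZMod l, (g'.indexEquiv t : ZMod l) = -t) :
    ∃ g : Iso (Ex63.bridge K) (Ex63.bridge K), g.indexEquiv = Equiv.neg (ZMod l) := by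
  refine ⟨{ indexEquiv := g'.indexEquiv
            indexEquiv_charts := fun e he => ?_
            capsPoly := g'.capsPoly
            capsPoly_plusFull := g'.capsPoly_plusFull
            globPoly := g'.globPoly
            globPoly_orbit := g'.globPoly_orbit
            compat := g'.compat }, Equiv.ext fun t => ?_⟩
  · have h1 : g'.indexEquiv.trans e ∈ (FlPMGroup.tautological l).toTorsor.charts :=
      g'.indexEquiv_charts e (by
        show e ∈ (FlPMGroup.tautological l).toTorsor.charts
        rw [FlPMGroup.toTorsor_tautological_charts]
        exact he)
    rw [FlPMGroup.toTorsor_tautological_charts] at h1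
    exact h1
  · exact (hκ' t).trans (congrFun (Equiv.neg_apply (ZMod l)) t).symm

end DThetaEllBridge

namespace DThetaPMEllHT

/-- **Prop 6.6 (iii) for the model theater forces the twisted `[−1]`-compatibility** ([IUTchI] Prop 6.6 (iii)
p. 165, Def 6.4 (iii) p. 163): if the automorphisms of the model `𝒟-Θ^{±ell}`-Hodge theater map ONTO the two
isomorphisms `±1` of the `𝔽_l^±`-group `𝔽_l`, the one over `−1` has an underlying automorphism of the
`𝒟-Θ^{ell}`-bridge with index bijection `t ↦ −t` (`Iso.index_eq`), whence the twisted form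
(`DThetaEllBridge.twistedNegCompat_of_negAut`). [claim: Mochizuki2012, status: disputed] -/
theorem twistedNegCompat_of_isoTorsor_model [NeZero l] (hV : Nonempty K.V)
    (h : IsoTorsor (Ex62.ht K) (Ex62.ht K)) :
    ∃ d : ZMod l, ∀ v, ∃ a : K.model v ≅ K.model v, K.labMap v a = labNeg (K.isLocal_model v) ∧
      ∃ b ∈ Ex63.lifts K (FlPM.mk d (-1)), a.hom ≫ K.phiEll v = K.phiEll v ≫ (K.atV v).map b.hom := by
  obtain ⟨-, hbij⟩ := h hV
  obtain ⟨g, hg⟩ := hbij.2 ⟨(Ex62.ht K).grpT.neg, fun e he => (Ex62.ht K).grpT.neg_trans_mem he⟩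
  have h1 : g.pmIso.indexEquiv = (Ex62.ht K).grpT.neg := congrArg Subtype.val hg
  have hκ' : ∀ t : ZMod l, (g.ellIso.indexEquiv t : ZMod l) = -t := fun t => by
    rw [← g.index_eq t, h1]
    exact FlPMGroup.tautological_neg_apply l t
  obtain ⟨g₀, hg₀⟩ := DThetaEllBridge.exists_negAut_model_of_negAut_modelTheater g.ellIso hκ'
  exact DThetaEllBridge.twistedNegCompat_of_negAut g₀ hg₀

/-- **[IUTchI] Prop 6.6 (iii) over a kit — the EXACT side condition** (p. 165; FACT-LIST F-2018 (iii)):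
`DThetaPMEllHT.IsoTorsor H₁ H₂` holds for ALL pairs of `𝒟-Θ^{±ell}`-Hodge theaters over `K` iff (vacuously `𝕍 = ∅`,
or) the twisted `[−1]`-compatibility holds — the SAME condition as for Prop 6.6 (ii)
(`DThetaEllBridge.forall_isoTorsor_iff_twistedNegCompat`). [claim: Mochizuki2012, status: disputed] -/
theorem forall_isoTorsor_iff_twistedNegCompat [NeZero l] :
    (∀ H₁ H₂ : K.DThetaPMEllHT, IsoTorsor H₁ H₂) ↔
      (Nonempty K.V → ∃ d : ZMod l, ∀ v, ∃ a : K.model v ≅ K.model v,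
        K.labMap v a = labNeg (K.isLocal_model v) ∧
          ∃ b ∈ Ex63.lifts K (FlPM.mk d (-1)), a.hom ≫ K.phiEll v = K.phiEll v ≫ (K.atV v).map b.hom) :=
  ⟨fun h hV => twistedNegCompat_of_isoTorsor_model hV (h _ _),
    fun h H₁ H₂ hV => by
      obtain ⟨d, hd⟩ := h hV
      exact isoTorsor_of_twistedNegCompat hd H₁ H₂ hV⟩

/-- **Prop 6.6 (iii) and (ii) over a kit are EQUIVALENT as schemata** (all pairs of theaters vs all pairs of
bridges): both are the twisted `[−1]`-compatibility. [claim: Mochizuki2012, status: disputed] -/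
theorem forall_isoTorsor_iff_forall_ellBridge_isoTorsor [NeZero l] :
    (∀ H₁ H₂ : K.DThetaPMEllHT, IsoTorsor H₁ H₂) ↔
      ∀ B₁ B₂ : K.DThetaEllBridge, DThetaEllBridge.IsoTorsor B₁ B₂ :=
  forall_isoTorsor_iff_twistedNegCompat.trans DThetaEllBridge.forall_isoTorsor_iff_twistedNegCompat.symm

/-- **Prop 6.8 (i) for the model theater forces the twisted `[−1]`-compatibility** ([IUTchI] Prop 6.8 (i)
pp. 167–168): if the underlying `𝒟-Θ^{ell}`-bridge of the model `𝒟-Θ^{±ell}`-Hodge theater has `2·|T| = 2l`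
automorphisms, then — these being determined by their index bijections (abc-iut-L5-t13's rigidity
`DThetaEllBridge.isoTorsor_injective`), of which there are `2l` — one of them has index bijection `t ↦ −t`.
[claim: Mochizuki2012, status: disputed] -/
theorem twistedNegCompat_of_ellBridgeSymmetry_model [NeZero l] (hV : Nonempty K.V)
    (h : EllBridgeSymmetry (Ex62.ht K)) :
    ∃ d : ZMod l, ∀ v, ∃ a : K.model v ≅ K.model v, K.labMap v a = labNeg (K.isLocal_model v) ∧
      ∃ b ∈ Ex63.lifts K (FlPM.mk d (-1)), a.hom ≫ K.phiEll v = K.phiEll v ≫ (K.atV v).map b.hom := by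
  classical
  obtain ⟨-, hcard⟩ := h hV
  have hl : 2 < l := two_lt_of_nonempty hV (Ex62.ht K)
  have hinj := DThetaEllBridge.isoTorsor_injective hV (Ex62.ht K).ellBridge (Ex62.ht K).ellBridge
  have hcod : Nat.card {κ : (Ex62.ht K).T ≃ (Ex62.ht K).T //
      (Ex62.ht K).ellBridge.torT.Compat (Ex62.ht K).ellBridge.torT κ} = 2 * Nat.card (Ex62.ht K).T := by
    change Nat.card {f : (Ex62.ht K).T ≃ (Ex62.ht K).T // ∀ e' ∈ (Ex62.ht K).grpT.toTorsor.charts,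
      f.trans e' ∈ (Ex62.ht K).grpT.toTorsor.charts} = _
    rw [(Ex62.ht K).grpT.toTorsor.card_isIso (Ex62.ht K).grpT.toTorsor hl]
    change 2 * l = 2 * Nat.card (ZMod l)
    rw [Nat.card_zmod]
  have hT : Nat.card (Ex62.ht K).T = l := by
    change Nat.card (ZMod l) = l
    exact Nat.card_zmod l
  haveI : Finite {κ : (Ex62.ht K).T ≃ (Ex62.ht K).T //
      (Ex62.ht K).ellBridge.torT.Compat (Ex62.ht K).ellBridge.torT κ} := by
    apply Nat.finite_of_card_ne_zero
    rw [hcod, hT]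
    omega
  haveI : Finite (DThetaEllBridge.Iso (Ex62.ht K).ellBridge (Ex62.ht K).ellBridge) := Finite.of_injective _ hinj
  obtain ⟨e⟩ := Finite.card_eq.mp (hcard.trans hcod.symm)
  have hsurj := (Finite.injective_iff_surjective_of_equiv e).mp hinj
  -- the index bijection `t ↦ −t`
  have hnegc : (Ex62.ht K).ellBridge.torT.Compat (Ex62.ht K).ellBridge.torT (Equiv.neg (ZMod l)) := by
    intro e' he'
    have he'' : e' ∈ (FlPMTorsor.tautological l).charts := by
      have h0 : e' ∈ (FlPMGroup.tautological l).toTorsor.charts := he'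
      rwa [FlPMGroup.toTorsor_tautological_charts] at h0
    have h2 := FlPMTorsor.tautological_compat_neg l e' he''
    show (Equiv.neg (ZMod l)).trans e' ∈ (FlPMGroup.tautological l).toTorsor.charts
    rw [FlPMGroup.toTorsor_tautological_charts]
    exact h2
  obtain ⟨g, hg⟩ := hsurj ⟨Equiv.neg (ZMod l), hnegc⟩
  have hκ : g.indexEquiv = Equiv.neg (ZMod l) := congrArg Subtype.val hg
  obtain ⟨g₀, hg₀⟩ := DThetaEllBridge.exists_negAut_model_of_negAut_modelTheater g
    (fun t => by rw [hκ]; exact congrFun (Equiv.neg_apply (ZMod l)) t)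
  exact DThetaEllBridge.twistedNegCompat_of_negAut g₀ hg₀

/-- **[IUTchI] Prop 6.8 (i) over a kit — the EXACT side condition** (pp. 167–168): every `𝒟-Θ^{±ell}`-Hodge
theater over `K` has the `𝔽_l^{⋊±}`-symmetry `EllBridgeSymmetry` iff (vacuously `𝕍 = ∅`, or) the twisted
`[−1]`-compatibility holds — the SAME condition as for Prop 6.6 (ii), (iii). [claim: Mochizuki2012, status: disputed] -/
theorem forall_ellBridgeSymmetry_iff_twistedNegCompat [NeZero l] :
    (∀ H : K.DThetaPMEllHT, EllBridgeSymmetry H) ↔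
      (Nonempty K.V → ∃ d : ZMod l, ∀ v, ∃ a : K.model v ≅ K.model v,
        K.labMap v a = labNeg (K.isLocal_model v) ∧
          ∃ b ∈ Ex63.lifts K (FlPM.mk d (-1)), a.hom ≫ K.phiEll v = K.phiEll v ≫ (K.atV v).map b.hom) :=
  ⟨fun h hV => twistedNegCompat_of_ellBridgeSymmetry_model hV (h _),
    fun h H hV => by
      obtain ⟨d, hd⟩ := h hV
      exact ellBridgeSymmetry_of_twistedNegCompat hd H hV⟩

end DThetaPMEllHT

/-- **Prop 6.6 (iii) over a kit is STRICTLY weaker than (β)**: at the separating kit of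
`exists_kit_forall_isoTorsor_not_negCompatModel` (abc-iut-L5-t13's one-place translated toy kit) Prop 6.6 (iii)
holds for ALL pairs of `𝒟-Θ^{±ell}`-Hodge theaters while (β) = `Ex63.NegCompatModel` fails.
[claim: Mochizuki2012, status: disputed] -/
theorem exists_kit_forall_isoTorsorHT_not_negCompatModel (l : ℕ) [Fact l.Prime] (hl : l ≠ 2) :
    ∃ K : PMBaseKit.{0} l, Nonempty K.V ∧
      (∀ H₁ H₂ : K.DThetaPMEllHT, DThetaPMEllHT.IsoTorsor H₁ H₂) ∧ ¬ Ex63.NegCompatModel K := by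
  haveI : NeZero l := ⟨(Fact.out : l.Prime).ne_zero⟩
  obtain ⟨K, hV, hiso, -, -, hN, -⟩ := exists_kit_forall_isoTorsor_not_negCompatModel l hl
  exact ⟨K, hV, DThetaPMEllHT.forall_isoTorsor_iff_forall_ellBridge_isoTorsor.mpr hiso, hN⟩

/-- **F-2018 — exact side conditions, assembled** ([IUTchI] Prop 6.6 (ii), (iii) p. 165, Prop 6.8 (i)
pp. 167–168): over every kit with `l ≠ 0` the three (β)-conditional schemata — Prop 6.6 (ii) for all pairs of
`𝒟-Θ^{ell}`-bridges, Prop 6.6 (iii) for all pairs of `𝒟-Θ^{±ell}`-Hodge theaters, Prop 6.8 (i) for all theaters —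
are pairwise EQUIVALENT, each being the twisted `[−1]`-compatibility. [claim: Mochizuki2012, status: disputed] -/
theorem isoTorsor_exact_side_conditions_agree [NeZero l] :
    ((∀ B₁ B₂ : K.DThetaEllBridge, DThetaEllBridge.IsoTorsor B₁ B₂) ↔
      ∀ H₁ H₂ : K.DThetaPMEllHT, DThetaPMEllHT.IsoTorsor H₁ H₂) ∧
    ((∀ H₁ H₂ : K.DThetaPMEllHT, DThetaPMEllHT.IsoTorsor H₁ H₂) ↔
      ∀ H : K.DThetaPMEllHT, DThetaPMEllHT.EllBridgeSymmetry H) :=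
  ⟨DThetaPMEllHT.forall_isoTorsor_iff_forall_ellBridge_isoTorsor.symm,
    DThetaPMEllHT.forall_isoTorsor_iff_twistedNegCompat.trans
      DThetaPMEllHT.forall_ellBridgeSymmetry_iff_twistedNegCompat.symm⟩

end PMBaseKit

end Literature.IUT.HodgeTheaters
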